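import Mathlib

/-!
# Heat-bath (single-site Glauber) kernels of a tilted product measure — basic identities

Abstract setting: a finite index type `ι`, a probability space `(E, lam)`, a bounded measurable
log-density `V : (ι → E) → ℝ`, the Gibbs measure `μ = (lam^{⊗ι}).tilted V` and its one-site
conditional ("heat-bath") laws `lam.tilted (V ∘ update x i)`.  We prove the DLR / self-adjointness
identities of the heat-bath averages `x ↦ ∫ f (update x i e) d(lam.tilted (V ∘ update x i))(e)`.
-/

noncomputable section

open MeasureTheory Function Real
open scoped ENNReal

namespace Summit.QuantumFields.YangMills.Theorems.StrongPinningPoincare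

namespace HeatBath

variable {ι : Type*} [DecidableEq ι] {E : Type*} [MeasurableSpace E]

/-! ### Product measure: integrating out one coordinate -/

/-- **Integrating out one coordinate** (`ℝ≥0∞` version): for a probability measure `lam`,
`∫⁻ f d(lam^{⊗ι}) = ∫⁻ (∫⁻ f (x[i ↦ e]) dlam(e)) d(lam^{⊗ι})(x)`. [folklore] -/
theorem lintegral_pi_eq_lintegral_update [Fintype ι] (lam : Measure E) [IsProbabilityMeasure lam]
    {f : (ι → E) → ℝ≥0∞} (hf : Measurable f) (i : ι) :
    ∫⁻ x, f x ∂(Measure.pi fun _ : ι => lam) =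
      ∫⁻ x, (∫⁻ e, f (update x i e) ∂lam) ∂(Measure.pi fun _ : ι => lam) := by
  set g : (ι → E) → ℝ≥0∞ := fun x ↦ ∫⁻ e, f (update x i e) ∂lam with hg_def
  have hg : Measurable g := Measurable.lintegral_prod_right (hf.comp measurable_update')
  have hgi : ∀ x e, g (update x i e) = g x := fun x e => by
    simp only [hg_def, update_idem]
  have h1 := lmarginal_erase' (μ := fun _ : ι => lam) f hf (Finset.mem_univ i)
  have h2 := lmarginal_erase' (μ := fun _ : ι => lam) g hg (Finset.mem_univ i)
  have h3 : (fun x ↦ ∫⁻ e, g (update x i e) ∂lam) = g := by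
    funext x
    simp only [hgi, lintegral_const, measure_univ, mul_one]
  rw [h3] at h2
  have hE : Nonempty E := by
    have h : (Set.univ : Set E).Nonempty :=
      nonempty_of_measure_ne_zero (by simp : lam Set.univ ≠ 0)
    exact ⟨h.some⟩
  obtain ⟨x₀⟩ : Nonempty (ι → E) := ⟨fun _ => hE.some⟩
  rw [lintegral_eq_lmarginal_univ x₀, lintegral_eq_lmarginal_univ x₀, h1]
  change (∫⋯∫⁻_Finset.univ.erase i, g ∂fun _ : ι => lam) x₀ = _
  rw [← h2]

/-- Bounded measurable real functions are integrable against finite measures. [folklore] -/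
theorem integrable_of_abs_le {α : Type*} [MeasurableSpace α] {ν : Measure α} [IsFiniteMeasure ν]
    {f : α → ℝ} (hf : Measurable f) {C : ℝ} (hC : ∀ s, |f s| ≤ C) : Integrable f ν :=
  Integrable.of_bound hf.aestronglyMeasurable C (ae_of_all _ fun s => by
    rw [Real.norm_eq_abs]; exact hC s)

/-- A parametric integral over one updated coordinate is measurable in the configuration.
[folklore] -/
theorem measurable_integral_update (lam : Measure E) [SFinite lam] {F : (ι → E) → ℝ}
    (hF : Measurable F) (i : ι) :
    Measurable fun x : ι → E => ∫ e, F (update x i e) ∂lam :=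
  ((hF.comp measurable_update').stronglyMeasurable.integral_prod_right' (ν := lam)).measurable

/-- **Integrating out one coordinate** (bounded real version): for a probability measure `lam`
and a bounded measurable `F`, `∫ F d(lam^{⊗ι}) = ∫ (∫ F (x[i ↦ e]) dlam(e)) d(lam^{⊗ι})(x)`.
[folklore] -/
theorem integral_pi_eq_integral_update [Fintype ι] (lam : Measure E) [IsProbabilityMeasure lam]
    {F : (ι → E) → ℝ} (hF : Measurable F) {M : ℝ} (hM : ∀ x, |F x| ≤ M) (i : ι) :
    ∫ x, F x ∂(Measure.pi fun _ : ι => lam) =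
      ∫ x, (∫ e, F (update x i e) ∂lam) ∂(Measure.pi fun _ : ι => lam) := by
  set piM : Measure (ι → E) := Measure.pi fun _ : ι => lam with hpiM
  haveI : IsProbabilityMeasure piM := by rw [hpiM]; infer_instance
  -- shift to a nonnegative function
  set G : (ι → E) → ℝ := fun x => F x + M with hG
  have hGm : Measurable G := hF.add_const M
  have hG0 : ∀ x, 0 ≤ G x := fun x => by
    have := (abs_le.1 (hM x)).1
    simp only [hG]; linarith
  have hGb : ∀ x, |G x| ≤ M + M := fun x => by
    rw [abs_of_nonneg (hG0 x)]
    have := (abs_le.1 (hM x)).2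
    simp only [hG]; linarith
  -- the identity for `G` via the `ℝ≥0∞` version
  have hGint : ∫ x, G x ∂piM = ∫ x, (∫ e, G (update x i e) ∂lam) ∂piM := by
    have hlhs : ∫ x, G x ∂piM = (∫⁻ x, ENNReal.ofReal (G x) ∂piM).toReal :=
      integral_eq_lintegral_of_nonneg_ae (ae_of_all _ hG0) hGm.aestronglyMeasurable
    have hinner : ∀ x, ∫⁻ e, ENNReal.ofReal (G (update x i e)) ∂lam =
        ENNReal.ofReal (∫ e, G (update x i e) ∂lam) := fun x => by
      rw [ofReal_integral_eq_lintegral_ofReal]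
      · exact integrable_of_abs_le (hGm.comp (measurable_update x)) (fun e => hGb _)
      · exact ae_of_all _ fun e => hG0 _
    have hmeas : Measurable fun x => ∫ e, G (update x i e) ∂lam :=
      measurable_integral_update lam hGm i
    have hnn : ∀ x, 0 ≤ ∫ e, G (update x i e) ∂lam := fun x => integral_nonneg fun e => hG0 _
    have hrhs : ∫ x, (∫ e, G (update x i e) ∂lam) ∂piM =
        (∫⁻ x, ENNReal.ofReal (∫ e, G (update x i e) ∂lam) ∂piM).toReal :=
      integral_eq_lintegral_of_nonneg_ae (ae_of_all _ hnn) hmeas.aestronglyMeasurable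
    have key := lintegral_pi_eq_lintegral_update lam (f := fun x => ENNReal.ofReal (G x))
      (ENNReal.measurable_ofReal.comp hGm) i
    rw [← hpiM] at key
    rw [hlhs, hrhs, key]
    simp only [hinner]
  -- back to `F`
  have hFint : Integrable F piM := integrable_of_abs_le hF hM
  have h1 : ∫ x, G x ∂piM = ∫ x, F x ∂piM + M := by
    simp only [hG]
    rw [integral_add hFint (integrable_const M)]
    simp
  have h2 : ∀ x, ∫ e, G (update x i e) ∂lam = ∫ e, F (update x i e) ∂lam + M := fun x => by
    have hi : Integrable (fun e => F (update x i e)) lam :=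
      integrable_of_abs_le (hF.comp (measurable_update x)) (fun e => hM _)
    simp only [hG]
    rw [integral_add hi (integrable_const M)]
    simp
  have h3 : ∫ x, (∫ e, G (update x i e) ∂lam) ∂piM = ∫ x, (∫ e, F (update x i e) ∂lam) ∂piM + M := by
    have hi : Integrable (fun x => ∫ e, F (update x i e) ∂lam) piM := by
      refine integrable_of_abs_le (measurable_integral_update lam hF i) (C := M) fun x => ?_
      have : |∫ e, F (update x i e) ∂lam| ≤ ∫ e, |F (update x i e)| ∂lam :=
        abs_integral_le_integral_abs
      refine this.trans ?_
      calc ∫ e, |F (update x i e)| ∂lam ≤ ∫ e, M ∂lam :=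
            integral_mono_of_nonneg (ae_of_all _ fun e => abs_nonneg _) (integrable_const M)
              (ae_of_all _ fun e => hM _)
        _ = M := by simp
    simp only [h2]
    rw [integral_add hi (integrable_const M)]
    simp
  linarith [hGint, h1, h3]


/-! ### One-site heat-bath laws of a tilted product measure -/

section Kernel

variable (lam : Measure E) [IsProbabilityMeasure lam] {V : (ι → E) → ℝ}

/-- The Boltzmann factor of a bounded measurable log-density is integrable on each fibre.
[folklore] -/
theorem integrable_exp_update (hV : Measurable V) {B : ℝ} (hB : ∀ x, |V x| ≤ B) (x : ι → E)
    (i : ι) : Integrable (fun e => exp (V (update x i e))) lam := by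
  refine Integrable.of_bound ((hV.comp (measurable_update x)).exp).aestronglyMeasurable (exp B)
    (ae_of_all _ fun e => ?_)
  rw [Real.norm_eq_abs, abs_exp, exp_le_exp]
  exact (abs_le.1 (hB _)).2

/-- The one-site heat-bath law `lam.tilted (V ∘ update x i)` is a probability measure.
[folklore] -/
theorem isProbabilityMeasure_heatBath (hV : Measurable V) {B : ℝ} (hB : ∀ x, |V x| ≤ B)
    (x : ι → E) (i : ι) : IsProbabilityMeasure (lam.tilted fun e => V (update x i e)) :=
  isProbabilityMeasure_tilted (integrable_exp_update lam hV hB x i)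

omit [IsProbabilityMeasure lam] in
/-- **The heat-bath average as a ratio**:
`∫ f(x[i↦e]) d(lam.tilted (V ∘ update x i)) = (∫ e^{V(x[i↦e])} f(x[i↦e]) dlam) / ∫ e^{V(x[i↦e])} dlam`.
[folklore] -/
theorem heatBath_eq_div (x : ι → E) (i : ι) (f : (ι → E) → ℝ) :
    ∫ e, f (update x i e) ∂(lam.tilted fun e => V (update x i e)) =
      (∫ e, exp (V (update x i e)) * f (update x i e) ∂lam) / ∫ e, exp (V (update x i e)) ∂lam := by
  rw [integral_tilted]
  simp_rw [smul_eq_mul, div_mul_eq_mul_div]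
  rw [integral_div]

omit [IsProbabilityMeasure lam] in
/-- The heat-bath average at site `i` does not depend on the `i`-th coordinate of the
conditioning configuration. [folklore] -/
theorem heatBath_update (x : ι → E) (i : ι) (a : E) (f : (ι → E) → ℝ) :
    ∫ e, f (update (update x i a) i e) ∂(lam.tilted fun e => V (update (update x i a) i e)) =
      ∫ e, f (update x i e) ∂(lam.tilted fun e => V (update x i e)) := by
  simp only [update_idem]

/-- The heat-bath average of a function bounded by `M` is bounded by `M`. [folklore] -/
theorem abs_heatBath_le (hV : Measurable V) {B : ℝ} (hB : ∀ x, |V x| ≤ B) (x : ι → E) (i : ι)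
    {f : (ι → E) → ℝ} {M : ℝ} (hM : ∀ x, |f x| ≤ M) :
    |∫ e, f (update x i e) ∂(lam.tilted fun e => V (update x i e))| ≤ M := by
  haveI := isProbabilityMeasure_heatBath lam hV hB x i
  have h := norm_integral_le_of_norm_le_const (μ := lam.tilted fun e => V (update x i e))
    (f := fun e => f (update x i e)) (ae_of_all _ fun e => by rw [Real.norm_eq_abs]; exact hM _)
  simpa only [probReal_univ, mul_one, Real.norm_eq_abs] using h

/-- The heat-bath average of a measurable function is measurable in the conditioning
configuration. [folklore] -/
theorem measurable_heatBath (hV : Measurable V) (i : ι) {f : (ι → E) → ℝ} (hf : Measurable f) :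
    Measurable fun x => ∫ e, f (update x i e) ∂(lam.tilted fun e => V (update x i e)) := by
  have hef : Measurable fun p : (ι → E) × E => exp (V (update p.1 i p.2)) :=
    (hV.comp measurable_update').exp
  have hZ : Measurable fun x : ι → E => ∫ e, exp (V (update x i e)) ∂lam :=
    (hef.stronglyMeasurable.integral_prod_right' (ν := lam)).measurable
  have hD : Measurable fun p : (ι → E) × E =>
      (exp (V (update p.1 i p.2)) / ∫ e, exp (V (update p.1 i e)) ∂lam) * f (update p.1 i p.2) :=
    (hef.div (hZ.comp measurable_fst)).mul (hf.comp measurable_update')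
  have hI := (hD.stronglyMeasurable.integral_prod_right' (ν := lam)).measurable
  simp only [integral_tilted, smul_eq_mul]
  exact hI

/-- The heat bath reproduces constants. [folklore] -/
theorem heatBath_const (hV : Measurable V) {B : ℝ} (hB : ∀ x, |V x| ≤ B) (x : ι → E) (i : ι)
    (c : ℝ) : ∫ _e, c ∂(lam.tilted fun e => V (update x i e)) = c := by
  haveI := isProbabilityMeasure_heatBath lam hV hB x i
  simp only [integral_const, probReal_univ, one_smul]

end Kernel

/-! ### The Gibbs measure `(lam^{⊗ι}).tilted V`: DLR identity and self-adjointness -/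

section Gibbs

variable [Fintype ι] (lam : Measure E) [IsProbabilityMeasure lam] {V : (ι → E) → ℝ}

omit [DecidableEq ι] in
/-- The Boltzmann factor of a bounded measurable log-density is integrable for the product
measure. [folklore] -/
theorem integrable_exp_pi (hV : Measurable V) {B : ℝ} (hB : ∀ x, |V x| ≤ B) :
    Integrable (fun x => exp (V x)) (Measure.pi fun _ : ι => lam) := by
  refine Integrable.of_bound hV.exp.aestronglyMeasurable (exp B) (ae_of_all _ fun x => ?_)
  rw [Real.norm_eq_abs, abs_exp, exp_le_exp]
  exact (abs_le.1 (hB _)).2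

omit [DecidableEq ι] in
/-- The Gibbs measure `(lam^{⊗ι}).tilted V` is a probability measure. [folklore] -/
theorem isProbabilityMeasure_gibbs (hV : Measurable V) {B : ℝ} (hB : ∀ x, |V x| ≤ B) :
    IsProbabilityMeasure ((Measure.pi fun _ : ι => lam).tilted V) :=
  isProbabilityMeasure_tilted (integrable_exp_pi lam hV hB)

/-- **Self-adjointness of the heat bath, explicit form**: for bounded measurable `f, h`,
`∫ h · (P_i f) dμ = ∫ N_f N_h / (Z · Z_i) d(lam^{⊗ι})` with the fibre numerators
`N_f(x) = ∫ e^{V(x[i↦e])} f(x[i↦e]) dlam(e)`, the fibre partition function `Z_i` and the total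
one `Z`; the right-hand side is symmetric in `f` and `h`. [folklore] -/
theorem integral_mul_heatBath_eq (hV : Measurable V) {B : ℝ} (hB : ∀ x, |V x| ≤ B) (i : ι)
    {f h : (ι → E) → ℝ} (hf : Measurable f) (hh : Measurable h) {Mf Mh : ℝ}
    (hMf : ∀ x, |f x| ≤ Mf) (hMh : ∀ x, |h x| ≤ Mh) :
    ∫ x, h x * ∫ e, f (update x i e) ∂(lam.tilted fun e => V (update x i e))
        ∂((Measure.pi fun _ : ι => lam).tilted V) =
      ∫ x, (∫ e, exp (V (update x i e)) * f (update x i e) ∂lam) *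
          (∫ e, exp (V (update x i e)) * h (update x i e) ∂lam) /
          ((∫ y, exp (V y) ∂(Measure.pi fun _ : ι => lam)) * ∫ e, exp (V (update x i e)) ∂lam)
        ∂(Measure.pi fun _ : ι => lam) := by
  set piM : Measure (ι → E) := Measure.pi fun _ : ι => lam with hpiM
  haveI : IsProbabilityMeasure piM := by rw [hpiM]; infer_instance
  set Z : ℝ := ∫ y, exp (V y) ∂piM with hZ
  have hZpos : 0 < Z := integral_exp_pos (integrable_exp_pi lam hV hB)
  set Ψ : (ι → E) → ℝ := fun x => (exp (V x) / Z) *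
    (h x * ∫ e, f (update x i e) ∂(lam.tilted fun e => V (update x i e))) with hΨ
  -- the left-hand side is `∫ Ψ d(lam^{⊗ι})`
  have hLHS : ∫ x, h x * ∫ e, f (update x i e) ∂(lam.tilted fun e => V (update x i e))
      ∂(piM.tilted V) = ∫ x, Ψ x ∂piM := by
    rw [integral_tilted]
    rfl
  -- `Ψ` is bounded and measurable
  have hΨm : Measurable Ψ :=
    (hV.exp.div_const Z).mul (hh.mul (measurable_heatBath lam hV i hf))
  have hMh0 : ∀ x, 0 ≤ Mh := fun x => (abs_nonneg _).trans (hMh x)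
  have hΨb : ∀ x, |Ψ x| ≤ (exp B / Z) * (Mh * Mf) := fun x => by
    simp only [hΨ]
    rw [abs_mul, abs_mul, abs_div, abs_exp, abs_of_pos hZpos]
    refine mul_le_mul (div_le_div_of_nonneg_right (exp_le_exp.2 (abs_le.1 (hB x)).2) hZpos.le)
      (mul_le_mul (hMh x) (abs_heatBath_le lam hV hB x i hMf) (abs_nonneg _) (hMh0 x))
      (mul_nonneg (abs_nonneg _) (abs_nonneg _)) (div_nonneg (exp_pos _).le hZpos.le)
  -- integrate out the `i`-th coordinate
  have hΨupd : ∀ x a, Ψ (update x i a) =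
      ((∫ e, exp (V (update x i e)) * f (update x i e) ∂lam) /
          (Z * ∫ e, exp (V (update x i e)) ∂lam)) * (exp (V (update x i a)) * h (update x i a)) := by
    intro x a
    simp only [hΨ]
    rw [heatBath_update, heatBath_eq_div]
    ring
  rw [hLHS, integral_pi_eq_integral_update lam hΨm hΨb i]
  refine integral_congr_ae (ae_of_all _ fun x => ?_)
  simp only [hΨupd, integral_const_mul]
  ring

/-- **Self-adjointness of the heat bath**: `∫ h (P_i f) dμ = ∫ f (P_i h) dμ` for bounded
measurable `f, h` and the Gibbs measure `μ = (lam^{⊗ι}).tilted V`. [folklore] -/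
theorem integral_mul_heatBath_comm (hV : Measurable V) {B : ℝ} (hB : ∀ x, |V x| ≤ B) (i : ι)
    {f h : (ι → E) → ℝ} (hf : Measurable f) (hh : Measurable h) {Mf Mh : ℝ}
    (hMf : ∀ x, |f x| ≤ Mf) (hMh : ∀ x, |h x| ≤ Mh) :
    ∫ x, h x * ∫ e, f (update x i e) ∂(lam.tilted fun e => V (update x i e))
        ∂((Measure.pi fun _ : ι => lam).tilted V) =
      ∫ x, f x * ∫ e, h (update x i e) ∂(lam.tilted fun e => V (update x i e))
        ∂((Measure.pi fun _ : ι => lam).tilted V) := by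
  rw [integral_mul_heatBath_eq lam hV hB i hf hh hMf hMh,
    integral_mul_heatBath_eq lam hV hB i hh hf hMh hMf]
  refine integral_congr_ae (ae_of_all _ fun x => ?_)
  simp only
  ring

/-- **DLR identity**: `∫ (P_i f) dμ = ∫ f dμ` — the Gibbs measure is invariant under one-site
heat-bath resampling. [folklore] -/
theorem integral_heatBath (hV : Measurable V) {B : ℝ} (hB : ∀ x, |V x| ≤ B) (i : ι)
    {f : (ι → E) → ℝ} (hf : Measurable f) {Mf : ℝ} (hMf : ∀ x, |f x| ≤ Mf) :
    ∫ x, ∫ e, f (update x i e) ∂(lam.tilted fun e => V (update x i e))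
        ∂((Measure.pi fun _ : ι => lam).tilted V) =
      ∫ x, f x ∂((Measure.pi fun _ : ι => lam).tilted V) := by
  have h1 : ∀ x : ι → E, |(1 : ℝ)| ≤ 1 := fun _ => by simp
  have key := integral_mul_heatBath_comm lam hV hB i hf measurable_const hMf (h := fun _ => 1) h1
  simp only [one_mul] at key
  rw [key]
  refine integral_congr_ae (ae_of_all _ fun x => ?_)
  simp only [heatBath_const lam hV hB x i, mul_one]

end Gibbs

end HeatBath

end Summit.QuantumFields.YangMills.Theorems.StrongPinningPoincare

end
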